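import Mathlib
import Literature.Computability.AlgebraicComplexity.StandardFamilies
import Literature.Computability.Complexity.NullstellensatzRefutation
import Literature.RingTheory.Nullstellensatz.SkodaBrownawellDegreeBound
import Summits.ValiantsHypothesis.ValiantsHypothesis.Theses.RefutationDegree
import Summits.ValiantsHypothesis.ValiantsHypothesis.Theorems.RefutationDegreeDefs
import Summits.ValiantsHypothesis.ValiantsHypothesis.Theorems.RefutationDegreeCertWindowQPLojZero
import Summits.ValiantsHypothesis.ValiantsHypothesis.Theorems.RefutationDegreeCertWindowQPCoeffDegree
import Summits.ValiantsHypothesis.ValiantsHypothesis.Theorems.RefutationDegreeRefutationBarrierStubHasSosRefOfHasNsRef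

/-!
# Crux `RefutationBarrier` (stmt-ValiantsHypothesis-5642), line `Sketch-ideator1`: the obstruction side
(what the crux FORCES), modulo the Skoda–Brownawell degree bound

Lead's file.  The card's (C2)/(C3) (`Cruxes/RefutationBarrier/Ideas/arc-contact-exponent.md`,
`BarrierNotes-ideator1.md`, `BorderDichotomy.md`): bounded-degree Nullstellensatz certificates are
COMPLETE for affine border lower bounds, so the barrier horn `RefutationBarrier` can only hold if
`per_n` is border-expressible at the quadratic size `m₁ = ⌊n²/2⌋+1` for all large `n` — Landsberg–
Manivel–Ressayre's `\overline{dc}(per_n) ≥ n²/2` (`LMR2013_thm_1_1_1`) would be sharp up to `+1`.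

Chain (for `n ≤ m`): `per_n` off the size-`m` border (`¬ InBorder n m`, resp. the padded permanent
`X₀₀^{m-n} per_n ∉ Δ[det_m]`) ⟹ Łojasiewicz inequality at infinity with exponent `0` for the equations
of Rep(n,m) (`lojZero_of_not_inBorder`, elementary; resp. `certWindowQP_lojZero` of the sibling line of
crux `CertWindowQP`) ⟹ a Nullstellensatz refutation of degree `≤ ((n²+1)m² + 1)·m` (the NAMED FACT
`Literature.RingTheory.Nullstellensatz.skodaBrownawellDegreeBound`, Skoda 1972 / Brownawell 1987, taken
as a hypothesis — every result below is CONDITIONAL on it) ⟹ a Hermitian-SOS refutation of the same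
degree (NS ⟹ SOS) ⟹ at `m = m₁`, degree `≤ n⁹`, contradicting `RefutationBarrier` at `c = 9`.
Results: `hasNsRef_of_not_inBorder` (stub T2 of the skeleton, conditional form),
`inBorder_of_refutationBarrier`, `mem_orbitClosure_of_refutationBarrier` (crux ⟹ quadratic border),
`not_refutationBarrier_of_io_notInBorder`, `not_refutationBarrier_of_io_notMem_orbitClosure`
(a border lower bound `⌊n²/2⌋+2` infinitely often — "LMR13 + 2" — refutes the crux).
-/

-- `Summit.ValiantsHypothesis.ValiantsHypothesis.…` is the tree's mandated single-conjunct layout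
-- (Sub = Summit), so the duplicated namespace component is intended.
set_option linter.dupNamespace false

noncomputable section

namespace Summit.ValiantsHypothesis.ValiantsHypothesis.Theorems.RefutationDegree

open scoped BigOperators
open Filter Topology MvPolynomial
open Literature.Computability.AlgebraicComplexity (perPoly paddedPerPoly orbitClosure detPoly)
open Literature.Computability.Complexity
open Literature.RingTheory.Nullstellensatz (skodaBrownawellDegreeBound)
open Summit.ValiantsHypothesis.ValiantsHypothesis.Theses.RefutationDegree

/-- NON-BORDER IS A ŁOJASIEWICZ INEQUALITY WITH EXPONENT `0`: if `per_n` is not a coefficientwise limit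
of size-`m` affine determinants, the squared coefficient distance `Σ_{μ ∈ supp P} |P.coeff μ (a)|²` is
bounded below by some `ε > 0` uniformly on unknown-space (otherwise points with distance `< 1/(k+1)`
converge coefficientwise). [folklore] -/
theorem lojZero_of_not_inBorder {n m : ℕ} (h : ¬ InBorder n m) :
    ∃ ε : ℝ, 0 < ε ∧ ∀ a : Unk n m → ℂ,
      ε ≤ ∑ μ ∈ (defect n m).support, ‖MvPolynomial.eval a ((defect n m).coeff μ)‖ ^ 2 := by
  classical
  by_contra hcon
  push Not at hcon
  choose a ha using fun k : ℕ => hcon (1 / ((k : ℝ) + 1)) (by positivity)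
  apply h
  refine ⟨a, fun μ => ?_⟩
  -- the whole (finite) sum of squares tends to `0`, hence each coefficient does
  have hsum : Tendsto (fun k => ∑ ν ∈ (defect n m).support,
      ‖MvPolynomial.eval (a k) ((defect n m).coeff ν)‖ ^ 2) atTop (𝓝 0) :=
    squeeze_zero (fun k => Finset.sum_nonneg fun ν _ => by positivity) (fun k => (ha k).le)
      tendsto_one_div_add_atTop_nhds_zero_nat
  by_cases hμ : μ ∈ (defect n m).support
  · have hle : ∀ k, ‖MvPolynomial.eval (a k) ((defect n m).coeff μ)‖ ^ 2 ≤
        ∑ ν ∈ (defect n m).support, ‖MvPolynomial.eval (a k) ((defect n m).coeff ν)‖ ^ 2 :=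
      fun k => Finset.single_le_sum (f := fun ν => ‖MvPolynomial.eval (a k) ((defect n m).coeff ν)‖ ^ 2)
        (fun ν _ => by positivity) hμ
    have hsq : Tendsto (fun k => ‖MvPolynomial.eval (a k) ((defect n m).coeff μ)‖ ^ 2) atTop (𝓝 0) :=
      squeeze_zero (fun k => by positivity) hle hsum
    have hnorm : Tendsto (fun k => ‖MvPolynomial.eval (a k) ((defect n m).coeff μ)‖) atTop (𝓝 0) := by
      have := hsq.sqrt
      simpa [Real.sqrt_sq (norm_nonneg _)] using this
    exact tendsto_zero_iff_norm_tendsto_zero.mpr hnorm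
  · rw [MvPolynomial.notMem_support_iff] at hμ
    simp [hμ]

/-- Literature vocabulary ⟹ the route's: a Nullstellensatz refutation of degree `≤ d` of the
coefficient system `μ ↦ P.coeff μ` (any finite axiom set `s`) is a `HasNsRef n m d` (multipliers
restricted to `s`, extended by `0`, the sum taken over `supp P`). [folklore] -/
theorem hasNsRef_of_hasNSRefutationOfDegree {n m d : ℕ}
    (H : HasNSRefutationOfDegree (fun μ : (Fin n × Fin n) →₀ ℕ => (defect n m).coeff μ) d) :
    HasNsRef n m d := by
  classical
  obtain ⟨s, g, hsum, hdeg⟩ := H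
  refine ⟨fun μ => if μ ∈ s then g μ else 0, fun μ => ?_, ?_⟩
  · by_cases hμ : μ ∈ s
    · simp only [hμ, if_true]; exact hdeg μ hμ
    · simp only [hμ, if_false, zero_mul, MvPolynomial.totalDegree_zero]; exact Nat.zero_le _
  · rw [← hsum]
    -- both sums equal the sum over `s ∩ supp P`
    rw [← Finset.sum_filter_add_sum_filter_not (defect n m).support (fun μ => μ ∈ s),
      ← Finset.sum_filter_add_sum_filter_not s (fun μ => μ ∈ (defect n m).support)]
    have h1 : ∑ μ ∈ (defect n m).support.filter (fun μ => μ ∉ s),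
        (if μ ∈ s then g μ else 0) * (defect n m).coeff μ = 0 :=
      Finset.sum_eq_zero fun μ hμ => by
        rw [Finset.mem_filter] at hμ
        simp only [hμ.2, if_false, zero_mul]
    have h2 : ∑ μ ∈ s.filter (fun μ => μ ∉ (defect n m).support), g μ * (defect n m).coeff μ = 0 :=
      Finset.sum_eq_zero fun μ hμ => by
        rw [Finset.mem_filter] at hμ
        rw [MvPolynomial.notMem_support_iff.mp hμ.2, mul_zero]
    rw [h1, h2, add_zero, add_zero]
    have hset : (defect n m).support.filter (fun μ => μ ∈ s)
        = s.filter (fun μ => μ ∈ (defect n m).support) := by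
      ext μ; simp only [Finset.mem_filter]; tauto
    rw [hset]
    exact Finset.sum_congr rfl fun μ hμ => by
      rw [Finset.mem_filter] at hμ
      simp only [hμ.1, if_true]

/-- The number of unknowns of Rep(n,m) and the Skoda–Brownawell budget: `((n²+1)m² + 1)·m`. -/
theorem sb_budget_eq (n m : ℕ) :
    (Fintype.card (Unk n m) + 1) * (0 + m) = (n ^ 2 + 1) * m ^ 3 + m := by
  simp only [Fintype.card_prod, Fintype.card_option, Fintype.card_fin, zero_add]
  ring

/-- **Stub T2, conditional form (Briançon–Skoda / Skoda–Brownawell dichotomy).** Modulo the named fact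
`skodaBrownawellDegreeBound` (Skoda 1972, Brownawell 1987): if `per_n` is NOT in the affine border at
size `m`, then Rep(n,m) has a Nullstellensatz refutation with every product of degree
`≤ (n²+1)m³ + m` — exponent `0` (`lojZero_of_not_inBorder`), generator degree `m`
(`certWindowQP_coeffDegree`), `(n²+1)m²` unknowns. -/
theorem hasNsRef_of_not_inBorder {n m : ℕ}
    (hSB : skodaBrownawellDegreeBound (σ := Unk n m) (ι := (Fin n × Fin n) →₀ ℕ))
    (h : ¬ InBorder n m) : HasNsRef n m ((n ^ 2 + 1) * m ^ 3 + m) := by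
  obtain ⟨ε, hε, hloj⟩ := lojZero_of_not_inBorder h
  have hns := hSB (defect n m).support (fun μ : (Fin n × Fin n) →₀ ℕ => (defect n m).coeff μ) m 0
    (fun μ _ => Theorems.certWindowQP_coeffDegree n m μ)
    ⟨ε, hε, fun a => by simpa using hloj a⟩
  rw [sb_budget_eq] at hns
  exact hasNsRef_of_hasNSRefutationOfDegree hns

/-- The same in Hermitian-SOS form (NS ⟹ SOS at the same degree, `stub_hasSosRef_of_hasNsRef`). -/
theorem hasSosRef_of_not_inBorder {n m : ℕ}
    (hSB : skodaBrownawellDegreeBound (σ := Unk n m) (ι := (Fin n × Fin n) →₀ ℕ))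
    (h : ¬ InBorder n m) : HasSosRef n m ((n ^ 2 + 1) * m ^ 3 + m) := by
  obtain ⟨ε, hε, hloj⟩ := lojZero_of_not_inBorder h
  have hns := hSB (defect n m).support (fun μ : (Fin n × Fin n) →₀ ℕ => (defect n m).coeff μ) m 0
    (fun μ _ => Theorems.certWindowQP_coeffDegree n m μ)
    ⟨ε, hε, fun a => by simpa using hloj a⟩
  rw [sb_budget_eq] at hns
  exact stub_hasSosRef_of_hasNsRef _ _ _ (hasNsRef_of_hasNSRefutationOfDegree hns)

/-- Off the ORBIT-CLOSURE border the same holds, in Hermitian-SOS form: modulo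
`skodaBrownawellDegreeBound`, if `n ≤ m` and `X₀₀^{m-n} per_n ∉ Δ[det_m]` then Rep(n,m) has a
Hermitian-SOS refutation with products of degree `≤ (n²+1)m³ + m` (`certWindowQP_lojZero` +
Skoda–Brownawell + NS ⟹ SOS; `certWindowQP_lojZero` is from the sibling line of crux `CertWindowQP`). -/
theorem hasSosRef_of_notMem_orbitClosure {n m : ℕ} [NeZero m]
    (hSB : skodaBrownawellDegreeBound (σ := Unk n m) (ι := (Fin n × Fin n) →₀ ℕ))
    (hnm : n ≤ m) (hpad : paddedPerPoly ℂ n m ∉ orbitClosure (detPoly (Fin m) ℂ)) :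
    HasSosRef n m ((n ^ 2 + 1) * m ^ 3 + m) := by
  obtain ⟨ε, hε, hloj⟩ := Theorems.certWindowQP_lojZero n m hnm hpad
  have hns := hSB (defect n m).support (fun μ : (Fin n × Fin n) →₀ ℕ => (defect n m).coeff μ) m 0
    (fun μ _ => Theorems.certWindowQP_coeffDegree n m μ)
    ⟨ε, hε, fun a => by
      -- `certWindowQP_lojZero` speaks about the route's inlined defect, which IS `defect n m`
      have h' : ε ≤ ∑ μ ∈ (defect n m).support,
          ‖MvPolynomial.eval a ((defect n m).coeff μ)‖ ^ 2 := hloj a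
      simpa using h'⟩
  rw [sb_budget_eq] at hns
  exact stub_hasSosRef_of_hasNsRef _ _ _ (hasNsRef_of_hasNSRefutationOfDegree hns)

/-- Degree budgets are monotone (same witnesses). [folklore] -/
theorem hasSosRef_mono (n m : ℕ) {D D' : ℕ} (hle : D ≤ D') : HasSosRef n m D → HasSosRef n m D' := by
  rintro ⟨k, q, h, hq, hh, hsum⟩
  exact ⟨k, q, h, fun i => (hq i).trans hle, fun μ => (hh μ).trans hle, hsum⟩

/-- Arithmetic: the Skoda–Brownawell budget at `m₁ = ⌊n²/2⌋+1` is `≤ n⁹` for `n ≥ 2`. -/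
theorem sb_budget_le_pow_nine {n : ℕ} (hn2 : 2 ≤ n) :
    (n ^ 2 + 1) * (n ^ 2 / 2 + 1) ^ 3 + (n ^ 2 / 2 + 1) ≤ n ^ 9 := by
  have hk : n ^ 2 / 2 + 1 ≤ n ^ 2 := by
    have h4 : 4 ≤ n ^ 2 := by nlinarith
    omega
  calc (n ^ 2 + 1) * (n ^ 2 / 2 + 1) ^ 3 + (n ^ 2 / 2 + 1)
      ≤ (n ^ 2 + 1) * (n ^ 2) ^ 3 + n ^ 2 := by gcongr
    _ ≤ n ^ 9 := by
        have h4 : 4 ≤ n ^ 2 := by nlinarith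
        have h62 : n ^ 2 ≤ n ^ 6 := Nat.pow_le_pow_right (by omega) (by norm_num)
        have h8 : n ^ 6 + n ^ 2 ≤ n ^ 8 := by
          have e : n ^ 8 = n ^ 2 * n ^ 6 := by ring
          rw [e]; nlinarith [h4, h62]
        have h9 : 2 * n ^ 8 ≤ n ^ 9 := by
          calc 2 * n ^ 8 ≤ n * n ^ 8 := by gcongr
            _ = n ^ 9 := by ring
        have e2 : (n ^ 2 + 1) * (n ^ 2) ^ 3 + n ^ 2 = n ^ 8 + (n ^ 6 + n ^ 2) := by ring
        rw [e2]; linarith [h8, h9]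

/-- `n ≤ ⌊n²/2⌋ + 1` (the quadratic size dominates the number of rows). -/
theorem le_quadSize (n : ℕ) : n ≤ n ^ 2 / 2 + 1 := by
  rcases Nat.lt_or_ge n 2 with h | h
  · interval_cases n <;> simp
  · have : 2 * n ≤ n ^ 2 := by nlinarith
    omega

/-- **(C2) The crux forces QUADRATIC AFFINE BORDER MEMBERSHIP** (modulo Skoda–Brownawell): if
`RefutationBarrier` holds then for all large `n`, `per_n` is a coefficientwise limit of size
`⌊n²/2⌋+1` affine determinantal expressions (`InBorder`). -/
theorem inBorder_of_refutationBarrier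
    (hSB : ∀ n m : ℕ, skodaBrownawellDegreeBound (σ := Unk n m) (ι := (Fin n × Fin n) →₀ ℕ))
    (hB : RefutationBarrier) : ∃ n₀ : ℕ, ∀ n ≥ n₀, InBorder n (n ^ 2 / 2 + 1) := by
  rw [refutationBarrier_iff] at hB
  obtain ⟨n₀, hn₀⟩ := hB 9
  refine ⟨max n₀ 2, fun n hn => ?_⟩
  by_contra hnb
  have hn2 : 2 ≤ n := le_trans (le_max_right _ _) hn
  exact hn₀ n (le_trans (le_max_left _ _) hn) _ le_rfl
    (hasSosRef_mono _ _ (sb_budget_le_pow_nine hn2) (hasSosRef_of_not_inBorder (hSB _ _) hnb))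

/-- **(C2') The crux forces QUADRATIC BORDER DETERMINANTAL COMPLEXITY** (modulo Skoda–Brownawell):
if `RefutationBarrier` holds then for all large `n` the padded permanent `X₀₀^{m₁-n} per_n` lies in
the orbit closure `Δ[det_{m₁}]`, `m₁ = ⌊n²/2⌋+1` — i.e. `\overline{dc}(per_n) ≤ ⌊n²/2⌋+1`,
Landsberg–Manivel–Ressayre's bound sharp up to `+1` (exactly sharp for odd `n`). -/
theorem mem_orbitClosure_of_refutationBarrier
    (hSB : ∀ n m : ℕ, skodaBrownawellDegreeBound (σ := Unk n m) (ι := (Fin n × Fin n) →₀ ℕ))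
    (hB : RefutationBarrier) :
    ∃ n₀ : ℕ, ∀ n ≥ n₀,
      paddedPerPoly ℂ n (n ^ 2 / 2 + 1) ∈ orbitClosure (detPoly (Fin (n ^ 2 / 2 + 1)) ℂ) := by
  rw [refutationBarrier_iff] at hB
  obtain ⟨n₀, hn₀⟩ := hB 9
  refine ⟨max n₀ 2, fun n hn => ?_⟩
  by_contra hnb
  have hn2 : 2 ≤ n := le_trans (le_max_right _ _) hn
  exact hn₀ n (le_trans (le_max_left _ _) hn) _ le_rfl
    (hasSosRef_mono _ _ (sb_budget_le_pow_nine hn2)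
      (hasSosRef_of_notMem_orbitClosure (hSB _ _) (le_quadSize n) hnb))

/-- **(C3) Conditional refutation of the crux**: modulo Skoda–Brownawell, infinitely many `n` with
`per_n` outside the quadratic affine border refute `RefutationBarrier`. -/
theorem not_refutationBarrier_of_io_notInBorder
    (hSB : ∀ n m : ℕ, skodaBrownawellDegreeBound (σ := Unk n m) (ι := (Fin n × Fin n) →₀ ℕ))
    (h : ∀ n₀ : ℕ, ∃ n ≥ n₀, ¬ InBorder n (n ^ 2 / 2 + 1)) : ¬ RefutationBarrier := by
  intro hB
  obtain ⟨n₀, hn₀⟩ := inBorder_of_refutationBarrier hSB hB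
  obtain ⟨n, hn, hnb⟩ := h n₀
  exact hnb (hn₀ n hn)

/-- **(C3') "LMR13 + 2" refutes the crux**: modulo Skoda–Brownawell, a border lower bound
`\overline{dc}(per_n) ≥ ⌊n²/2⌋+2` for infinitely many `n` (`X₀₀^{m₁-n} per_n ∉ Δ[det_{m₁}]`) refutes
`RefutationBarrier`, by explicit (non-constructive) Hermitian-SOS certificates of degree `≤ n⁹`. -/
theorem not_refutationBarrier_of_io_notMem_orbitClosure
    (hSB : ∀ n m : ℕ, skodaBrownawellDegreeBound (σ := Unk n m) (ι := (Fin n × Fin n) →₀ ℕ))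
    (h : ∀ n₀ : ℕ, ∃ n ≥ n₀,
      paddedPerPoly ℂ n (n ^ 2 / 2 + 1) ∉ orbitClosure (detPoly (Fin (n ^ 2 / 2 + 1)) ℂ)) :
    ¬ RefutationBarrier := by
  intro hB
  obtain ⟨n₀, hn₀⟩ := mem_orbitClosure_of_refutationBarrier hSB hB
  obtain ⟨n, hn, hnb⟩ := h n₀
  exact hnb (hn₀ n hn)

end Summit.ValiantsHypothesis.ValiantsHypothesis.Theorems.RefutationDegree

end
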